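import Mathlib.Analysis.SpecialFunctions.Trigonometric.ArctanDeriv
import Mathlib.Analysis.SpecialFunctions.Complex.Arg
import Mathlib.Analysis.SpecialFunctions.Complex.LogDeriv
import Literature.NumberTheory.Transcendental.KZDilationArctanSector
import Literature.NumberTheory.Transcendental.SemialgebraicMapsProofs
import HarnessLib

/-!
# Small Nash representatives of integer combinations of arguments (angle halving)

For the arctangent sector of the dilation pencil (`KZDilationArctanSector.lean`) one needs, for an
INTEGER combination `Θ = Σ_k F_k · arg w_k(x)` of the principal arguments of complex Nash functions
`w_k : (a,b) → ℂ ∖ ℝ_{≤0}`, a REAL NASH function `T` with `arctan T = Θ / 2^{m+1}` on `(a,b)`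
(`exists_nash_arctan_eq_sum_arg`). Construction, entirely explicit (no root selection):
* `arctan (im w / (‖w‖ + re w)) = arg w / 2` for `w ∉ ℝ_{≤0}` (half-angle, `arctan_im_div_norm_add_re`);
* the halving map `t ↦ t/(1 + √(1+t²))` satisfies `arctan ∘ halve = (arctan)/2` (`arctan_halve`),
  so `m` iterations give Nash `g_k` with `arctan g_k = arg w_k / 2^{m+1}`;
* `u_k := (1 + i s_k g_k)/√(1 + g_k²) = exp(i s_k arctan g_k)` (`s_k = ±1` the sign of `F_k`) and
  `W := Π_k u_k^{|F_k|} = exp(i Θ/2^{m+1})`; for `2^m > Σ_k |F_k|` one has `|Θ/2^{m+1}| < π/2`, so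
  `T := im W / re W = tan(Θ/2^{m+1})` and `arctan T = Θ/2^{m+1}`; `re W`, `im W` are polynomial in
  the `re u_k, im u_k`, hence Nash.
This is the "division of the angle" replacing the `n`-th root of a unimodular loop in the lift of
vanishing combinations of arguments (complex poles) for crux `DilationLiftAtOne` of route
`KontsevichZagierPeriods/LiftingCriteria`.

Everything is proved; no `def`, no named fact.

## References
* J. Bochnak, M. Coste, M.-F. Roy, *Real Algebraic Geometry* (1998), Prop. 2.2.6. [`BochnakCosteRoy1998`]
-/

noncomputable section

open Set Filter MvPolynomial Complex
open scoped BigOperators Topology Real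
open Literature.ModelTheory.ExponentialFields

namespace Literature.NumberTheory.Transcendental

namespace KZ.DilationArctanSector

/-! ### Trigonometry: half angles -/

/-- `tan(y/2) = sin y / (1 + cos y)` when `cos(y/2) ≠ 0`. [folklore] -/
theorem tan_half_eq_sin_div_one_add_cos {y : ℝ} (h : Real.cos (y / 2) ≠ 0) :
    Real.tan (y / 2) = Real.sin y / (1 + Real.cos y) := by
  have hs : Real.sin y = 2 * Real.sin (y / 2) * Real.cos (y / 2) := by
    rw [← Real.sin_two_mul]; ring_nf
  have hc : 1 + Real.cos y = 2 * Real.cos (y / 2) ^ 2 := by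
    have := Real.cos_two_mul (y / 2)
    rw [show 2 * (y / 2) = y by ring] at this
    linarith
  rw [Real.tan_eq_sin_div_cos, hs, hc]
  field_simp

/-- **Halving an arctangent.** `arctan (t / (1 + √(1 + t²))) = arctan(t)/2`. [folklore] -/
theorem arctan_halve (t : ℝ) :
    Real.arctan (t / (1 + Real.sqrt (1 + t ^ 2))) = Real.arctan t / 2 := by
  set y := Real.arctan t with hy
  have hy1 : -(π / 2) < y := Real.neg_pi_div_two_lt_arctan t
  have hy2 : y < π / 2 := Real.arctan_lt_pi_div_two t
  have hcos : Real.cos (y / 2) ≠ 0 := by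
    refine (Real.cos_pos_of_mem_Ioo ⟨?_, ?_⟩).ne' <;> linarith [Real.pi_pos]
  have hs : 0 < Real.sqrt (1 + t ^ 2) := Real.sqrt_pos.mpr (by positivity)
  have htan : Real.tan (y / 2) = t / (1 + Real.sqrt (1 + t ^ 2)) := by
    rw [tan_half_eq_sin_div_one_add_cos hcos, hy, Real.sin_arctan, Real.cos_arctan]
    field_simp
    ring
  rw [← htan, Real.arctan_tan] <;> linarith

/-- **Half the argument.** For `w ∉ ℝ_{≤0}`: `arctan (im w / (‖w‖ + re w)) = arg(w)/2`. [folklore] -/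
theorem arctan_im_div_norm_add_re {w : ℂ} (hw : w ∈ slitPlane) :
    Real.arctan (w.im / (‖w‖ + w.re)) = w.arg / 2 := by
  have hw0 : w ≠ 0 := (mem_slitPlane_iff_arg.mp hw).2
  have hπ : w.arg ≠ π := (mem_slitPlane_iff_arg.mp hw).1
  have h1 : -π < w.arg := neg_pi_lt_arg w
  have h2 : w.arg < π := lt_of_le_of_ne (arg_le_pi w) hπ
  have hcos : Real.cos (w.arg / 2) ≠ 0 := by
    refine (Real.cos_pos_of_mem_Ioo ⟨?_, ?_⟩).ne' <;> linarith
  have hn : 0 < ‖w‖ := norm_pos_iff.mpr hw0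
  have hden : ‖w‖ + w.re ≠ 0 := by
    intro h
    have hre : w.re = -‖w‖ := by linarith
    rcases hw with hpos | him
    · linarith
    · have : w.im ^ 2 = 0 := by
        have hsq : ‖w‖ ^ 2 = w.re ^ 2 + w.im ^ 2 := by
          rw [Complex.sq_norm, Complex.normSq_apply]; ring
        rw [hre] at hsq
        nlinarith
      exact him (pow_eq_zero_iff (n := 2) (by norm_num) |>.mp this)
  have htan : Real.tan (w.arg / 2) = w.im / (‖w‖ + w.re) := by
    rw [tan_half_eq_sin_div_one_add_cos hcos, sin_arg, cos_arg hw0]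
    field_simp
  rw [← htan, Real.arctan_tan] <;> linarith

/-- `exp(i·arctan v) = (1 + i v)/√(1 + v²)`. [folklore] -/
theorem exp_arctan_mul_I (v : ℝ) :
    Complex.exp ((Real.arctan v : ℂ) * I) =
      ((1 : ℂ) + (v : ℂ) * I) * (((Real.sqrt (1 + v ^ 2))⁻¹ : ℝ) : ℂ) := by
  rw [Complex.exp_mul_I, ← Complex.ofReal_cos, ← Complex.ofReal_sin, Real.cos_arctan,
    Real.sin_arctan]
  have hs : Real.sqrt (1 + v ^ 2) ≠ 0 := (Real.sqrt_pos.mpr (by positivity)).ne'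
  apply Complex.ext <;> simp [div_eq_mul_inv]

/-- A real number of absolute value `< π/2` is recovered from `exp(iΦ)`:
`arctan (im/re) = Φ`. [folklore] -/
theorem arctan_im_div_re_exp {Φ : ℝ} (h : |Φ| < π / 2) :
    Real.arctan ((Complex.exp ((Φ : ℂ) * I)).im / (Complex.exp ((Φ : ℂ) * I)).re) = Φ := by
  rw [Complex.exp_ofReal_mul_I_im, Complex.exp_ofReal_mul_I_re, ← Real.tan_eq_sin_div_cos,
    Real.arctan_tan] <;> linarith [abs_lt.mp h]

/-! ### Nash closure facts on an interval -/

section Nash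

variable {a b : ℝ}

/-- The halved function `x ↦ f x/(1 + √(1 + (f x)²))` is `ℚ`-semialgebraic when `f` is.
[cite: BochnakCosteRoy1998, Prop. 2.2.6] -/
theorem isSemialgebraicFunOn_halve {f : ℝ → ℝ}
    (hI : IsSemialgebraic ℚ {t : Fin 1 → ℝ | t 0 ∈ Ioo a b})
    (hf : IsSemialgebraicFunOn ℚ {t : Fin 1 → ℝ | t 0 ∈ Ioo a b} (fun t => f (t 0))) :
    IsSemialgebraicFunOn ℚ {t : Fin 1 → ℝ | t 0 ∈ Ioo a b}
      (fun t => f (t 0) / (1 + Real.sqrt (1 + f (t 0) ^ 2))) := by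
  have h1 : IsSemialgebraicFunOn ℚ {t : Fin 1 → ℝ | t 0 ∈ Ioo a b} (fun _ => (1:ℝ)) := by
    simpa using isSemialgebraicFunOn_const_natCast hI 1
  have hsq : IsSemialgebraicFunOn ℚ {t : Fin 1 → ℝ | t 0 ∈ Ioo a b} (fun t => 1 + f (t 0) ^ 2) :=
    (h1.fun_add (hf.fun_mul hf)).congr fun _ _ => by ring
  have hsqrt : IsSemialgebraicFunOn ℚ {t : Fin 1 → ℝ | t 0 ∈ Ioo a b}
      (fun t => Real.sqrt (1 + f (t 0) ^ 2)) := IsSemialgebraicFunOn.sqrt_holds hsq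
  exact (hf.fun_mul (h1.fun_add hsqrt).fun_inv).congr fun _ _ => by rw [div_eq_mul_inv]

/-- The halved function is real-analytic when `f` is. [folklore] -/
theorem analyticAt_halve {f : ℝ → ℝ} {x : ℝ} (hf : AnalyticAt ℝ f x) :
    AnalyticAt ℝ (fun x => f x / (1 + Real.sqrt (1 + f x ^ 2))) x := by
  have hpos : 0 < 1 + f x ^ 2 := by positivity
  have hsqrt : AnalyticAt ℝ (fun x => Real.sqrt (1 + f x ^ 2)) x := by
    have h := analyticAt_rpow_const_comp (analyticAt_const.add (hf.pow 2)) hpos (1 / 2 : ℝ)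
    refine h.congr ?_
    filter_upwards with y
    rw [Real.sqrt_eq_rpow]
    rfl
  refine hf.div (analyticAt_const.add hsqrt) ?_
  have : 0 ≤ Real.sqrt (1 + f x ^ 2) := Real.sqrt_nonneg _
  linarith

/-- Iterated halving: a Nash `g` with `arctan g = (arctan f)/2^m`. [folklore] -/
theorem exists_nash_arctan_eq_div_pow {f : ℝ → ℝ}
    (hI : IsSemialgebraic ℚ {t : Fin 1 → ℝ | t 0 ∈ Ioo a b})
    (hf : IsSemialgebraicFunOn ℚ {t : Fin 1 → ℝ | t 0 ∈ Ioo a b} (fun t => f (t 0)))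
    (hfa : ∀ x ∈ Ioo a b, AnalyticAt ℝ f x) (m : ℕ) :
    ∃ g : ℝ → ℝ, IsSemialgebraicFunOn ℚ {t : Fin 1 → ℝ | t 0 ∈ Ioo a b} (fun t => g (t 0)) ∧
      (∀ x ∈ Ioo a b, AnalyticAt ℝ g x) ∧ ∀ x, Real.arctan (g x) = Real.arctan (f x) / 2 ^ m := by
  induction m with
  | zero => exact ⟨f, hf, hfa, fun x => by simp⟩
  | succ m ih =>
    obtain ⟨g, hgs, hga, hg⟩ := ih
    refine ⟨fun x => g x / (1 + Real.sqrt (1 + g x ^ 2)), isSemialgebraicFunOn_halve hI hgs,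
      fun x hx => analyticAt_halve (hga x hx), fun x => ?_⟩
    rw [arctan_halve, hg, pow_succ]
    ring

/-- Real and imaginary parts of a product of two complex-valued functions with `ℚ`-semialgebraic
real and imaginary parts are `ℚ`-semialgebraic. [cite: BochnakCosteRoy1998, Prop. 2.2.6] -/
theorem isSemialgebraicFunOn_re_im_mul {u v : ℝ → ℂ}
    (hur : IsSemialgebraicFunOn ℚ {t : Fin 1 → ℝ | t 0 ∈ Ioo a b} (fun t => (u (t 0)).re))
    (hui : IsSemialgebraicFunOn ℚ {t : Fin 1 → ℝ | t 0 ∈ Ioo a b} (fun t => (u (t 0)).im))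
    (hvr : IsSemialgebraicFunOn ℚ {t : Fin 1 → ℝ | t 0 ∈ Ioo a b} (fun t => (v (t 0)).re))
    (hvi : IsSemialgebraicFunOn ℚ {t : Fin 1 → ℝ | t 0 ∈ Ioo a b} (fun t => (v (t 0)).im)) :
    IsSemialgebraicFunOn ℚ {t : Fin 1 → ℝ | t 0 ∈ Ioo a b} (fun t => (u (t 0) * v (t 0)).re) ∧
    IsSemialgebraicFunOn ℚ {t : Fin 1 → ℝ | t 0 ∈ Ioo a b} (fun t => (u (t 0) * v (t 0)).im) := by
  constructor
  · exact ((hur.fun_mul hvr).fun_sub (hui.fun_mul hvi)).congr fun _ _ => by simp [Complex.mul_re]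
  · exact ((hur.fun_mul hvi).fun_add (hui.fun_mul hvr)).congr fun _ _ => by simp [Complex.mul_im]

/-- Real and imaginary parts of natural powers. [cite: BochnakCosteRoy1998, Prop. 2.2.6] -/
theorem isSemialgebraicFunOn_re_im_pow {u : ℝ → ℂ}
    (hI : IsSemialgebraic ℚ {t : Fin 1 → ℝ | t 0 ∈ Ioo a b})
    (hur : IsSemialgebraicFunOn ℚ {t : Fin 1 → ℝ | t 0 ∈ Ioo a b} (fun t => (u (t 0)).re))
    (hui : IsSemialgebraicFunOn ℚ {t : Fin 1 → ℝ | t 0 ∈ Ioo a b} (fun t => (u (t 0)).im)) (n : ℕ) :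
    IsSemialgebraicFunOn ℚ {t : Fin 1 → ℝ | t 0 ∈ Ioo a b} (fun t => (u (t 0) ^ n).re) ∧
    IsSemialgebraicFunOn ℚ {t : Fin 1 → ℝ | t 0 ∈ Ioo a b} (fun t => (u (t 0) ^ n).im) := by
  induction n with
  | zero =>
    constructor
    · simpa using isSemialgebraicFunOn_const_natCast hI 1
    · simpa using isSemialgebraicFunOn_const_natCast hI 0
  | succ n ih =>
    have h := isSemialgebraicFunOn_re_im_mul (u := fun x => u x ^ n) (v := u) ih.1 ih.2 hur hui
    simpa only [pow_succ] using h

/-- Real and imaginary parts of finite products. [cite: BochnakCosteRoy1998, Prop. 2.2.6] -/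
theorem isSemialgebraicFunOn_re_im_prod {A : ℕ} {u : Fin A → ℝ → ℂ}
    (hI : IsSemialgebraic ℚ {t : Fin 1 → ℝ | t 0 ∈ Ioo a b})
    (hur : ∀ k, IsSemialgebraicFunOn ℚ {t : Fin 1 → ℝ | t 0 ∈ Ioo a b} (fun t => (u k (t 0)).re))
    (hui : ∀ k, IsSemialgebraicFunOn ℚ {t : Fin 1 → ℝ | t 0 ∈ Ioo a b} (fun t => (u k (t 0)).im))
    (s : Finset (Fin A)) :
    IsSemialgebraicFunOn ℚ {t : Fin 1 → ℝ | t 0 ∈ Ioo a b} (fun t => (∏ k ∈ s, u k (t 0)).re) ∧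
    IsSemialgebraicFunOn ℚ {t : Fin 1 → ℝ | t 0 ∈ Ioo a b} (fun t => (∏ k ∈ s, u k (t 0)).im) := by
  classical
  induction s using Finset.induction_on with
  | empty =>
    constructor
    · simpa using isSemialgebraicFunOn_const_natCast hI 1
    · simpa using isSemialgebraicFunOn_const_natCast hI 0
  | insert k s hk ih =>
    have h := isSemialgebraicFunOn_re_im_mul (u := u k) (v := fun x => ∏ j ∈ s, u j x)
      (hur k) (hui k) ih.1 ih.2
    simpa only [Finset.prod_insert hk] using h

end Nash

/-! ### The small Nash representative of `Σ_k F_k arg w_k` -/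

/-- For `w ∉ ℝ_{≤0}`: `‖w‖ + re w ≠ 0`. [folklore] -/
theorem norm_add_re_ne_zero {w : ℂ} (hw : w ∈ slitPlane) : ‖w‖ + w.re ≠ 0 := by
  intro h
  have hre : w.re = -‖w‖ := by linarith
  rcases hw with hpos | him
  · have : 0 ≤ ‖w‖ := norm_nonneg w
    linarith
  · have hsq : ‖w‖ ^ 2 = w.re ^ 2 + w.im ^ 2 := by
      rw [Complex.sq_norm, Complex.normSq_apply]; ring
    rw [hre] at hsq
    have : w.im ^ 2 = 0 := by nlinarith
    exact him (pow_eq_zero_iff (n := 2) (by norm_num) |>.mp this)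

/-- **Small Nash representatives of integer combinations of arguments.** Let `w_k : (a,b) → ℂ`
take values off the closed negative real axis, with `ℚ`-semialgebraic and real-analytic real and
imaginary parts, and let `F_k ∈ ℤ`. Then there are `m` and a real function `T`, `ℚ`-semialgebraic
and real-analytic on `(a,b)`, with `arctan (T x) = (Σ_k F_k · arg (w_k x)) / 2^{m+1}` on `(a,b)`.
[cite: BochnakCosteRoy1998, Prop. 2.2.6] -/
theorem exists_nash_arctan_eq_sum_arg {a b : ℝ}
    (hI : IsSemialgebraic ℚ {t : Fin 1 → ℝ | t 0 ∈ Ioo a b}) {A : ℕ} (w : Fin A → ℝ → ℂ)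
    (hre : ∀ k, IsSemialgebraicFunOn ℚ {t : Fin 1 → ℝ | t 0 ∈ Ioo a b} (fun t => (w k (t 0)).re))
    (him : ∀ k, IsSemialgebraicFunOn ℚ {t : Fin 1 → ℝ | t 0 ∈ Ioo a b} (fun t => (w k (t 0)).im))
    (hrea : ∀ k, ∀ x ∈ Ioo a b, AnalyticAt ℝ (fun x => (w k x).re) x)
    (hima : ∀ k, ∀ x ∈ Ioo a b, AnalyticAt ℝ (fun x => (w k x).im) x)
    (hslit : ∀ k, ∀ x ∈ Ioo a b, w k x ∈ slitPlane) (F : Fin A → ℤ) :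
    ∃ (m : ℕ) (T : ℝ → ℝ), IsSemialgebraicFunOn ℚ {t : Fin 1 → ℝ | t 0 ∈ Ioo a b} (fun t => T (t 0)) ∧
      (∀ x ∈ Ioo a b, AnalyticAt ℝ T x) ∧
      ∀ x ∈ Ioo a b, Real.arctan (T x) = (∑ k, (F k : ℝ) * Complex.arg (w k x)) / 2 ^ (m + 1) := by
  classical
  -- `m` with `Σ |F_k| < 2^m`
  obtain ⟨m, hm⟩ : ∃ m : ℕ, (∑ k, |(F k : ℝ)|) < 2 ^ m :=
    pow_unbounded_of_one_lt (∑ k, |(F k : ℝ)|) (by norm_num : (1:ℝ) < 2)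
  -- the half arguments `t₁ k = im/(‖w‖ + re)` are Nash with `arctan t₁ = arg/2`
  have hnorm : ∀ k, IsSemialgebraicFunOn ℚ {t : Fin 1 → ℝ | t 0 ∈ Ioo a b}
      (fun t => ‖w k (t 0)‖) := fun k => by
    have h := IsSemialgebraicFunOn.sqrt_holds
      (((hre k).fun_mul (hre k)).fun_add ((him k).fun_mul (him k)))
    refine h.congr fun t _ => ?_
    show Real.sqrt ((w k (t 0)).re * (w k (t 0)).re + (w k (t 0)).im * (w k (t 0)).im) = ‖w k (t 0)‖
    rw [Complex.norm_eq_sqrt_sq_add_sq]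
    ring_nf
  have hnorma : ∀ k, ∀ x ∈ Ioo a b, AnalyticAt ℝ (fun x => ‖w k x‖) x := fun k x hx => by
    have hw0 : w k x ≠ 0 := (mem_slitPlane_iff_arg.mp (hslit k x hx)).2
    have hpos : 0 < (w k x).re ^ 2 + (w k x).im ^ 2 := by
      have h := Complex.normSq_pos.mpr hw0
      rw [Complex.normSq_apply] at h
      nlinarith [h]
    have h := analyticAt_rpow_const_comp (((hrea k x hx).pow 2).add ((hima k x hx).pow 2)) hpos
      (1 / 2 : ℝ)
    refine h.congr ?_
    filter_upwards with y
    rw [Complex.norm_eq_sqrt_sq_add_sq, Real.sqrt_eq_rpow]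
    rfl
  have ht1s : ∀ k, IsSemialgebraicFunOn ℚ {t : Fin 1 → ℝ | t 0 ∈ Ioo a b}
      (fun t => (w k (t 0)).im / (‖w k (t 0)‖ + (w k (t 0)).re)) := fun k =>
    ((him k).fun_mul ((hnorm k).fun_add (hre k)).fun_inv).congr fun _ _ => by rw [div_eq_mul_inv]
  have ht1a : ∀ k, ∀ x ∈ Ioo a b,
      AnalyticAt ℝ (fun x => (w k x).im / (‖w k x‖ + (w k x).re)) x := fun k x hx =>
    (hima k x hx).div ((hnorma k x hx).add (hrea k x hx)) (norm_add_re_ne_zero (hslit k x hx))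
  -- iterate the halving `m` times
  choose g hgs hga hg using fun k => exists_nash_arctan_eq_div_pow hI (ht1s k) (ht1a k) m
  have hgarg : ∀ k, ∀ x ∈ Ioo a b, Real.arctan (g k x) = Complex.arg (w k x) / 2 ^ (m + 1) := by
    intro k x hx
    rw [hg k x, arctan_im_div_norm_add_re (hslit k x hx), pow_succ]
    ring
  -- signs, multiplicities, unit vectors `u_k = exp(i s_k arctan g_k)` and their product `W`
  set s : Fin A → ℝ := fun k => if 0 ≤ F k then 1 else -1 with hs_def
  set n : Fin A → ℕ := fun k => (F k).natAbs with hn_def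
  have hsn : ∀ k, (n k : ℝ) * s k = (F k : ℝ) := by
    intro k
    by_cases h : 0 ≤ F k
    · have h'' : ((F k).natAbs : ℝ) = (F k : ℝ) := by
        rw [← Int.cast_natCast, Int.natCast_natAbs, Int.cast_abs, abs_of_nonneg]
        exact_mod_cast h
      simp [hs_def, hn_def, h, h'']
    · have h'' : ((F k).natAbs : ℝ) = -(F k : ℝ) := by
        rw [← Int.cast_natCast, Int.natCast_natAbs, Int.cast_abs, abs_of_neg]
        exact_mod_cast (not_le.mp h)
      simp [hs_def, hn_def, h, h'']
  have hsarctan : ∀ k (y : ℝ), Real.arctan (s k * y) = s k * Real.arctan y := by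
    intro k y
    by_cases h : 0 ≤ F k
    · simp [hs_def, h]
    · simp [hs_def, h, Real.arctan_neg]
  have hsalg : ∀ k, IsAlgebraic ℚ (s k) := by
    intro k
    by_cases h : 0 ≤ F k
    · simp only [hs_def, h, if_true]; exact isAlgebraic_one
    · simp only [hs_def, h, if_false]; exact isAlgebraic_one.neg
  set u : Fin A → ℝ → ℂ := fun k x =>
    ((1 : ℂ) + ((s k * g k x : ℝ) : ℂ) * I) * (((Real.sqrt (1 + (s k * g k x) ^ 2))⁻¹ : ℝ) : ℂ)
    with hu_def
  have hu_exp : ∀ k x, u k x = Complex.exp ((Real.arctan (s k * g k x) : ℂ) * I) := fun k x =>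
    (exp_arctan_mul_I _).symm
  set Φ : ℝ → ℝ := fun x => (∑ k, (F k : ℝ) * Complex.arg (w k x)) / 2 ^ (m + 1) with hΦ_def
  set W : ℝ → ℂ := fun x => ∏ k, u k x ^ n k with hW_def
  have hW : ∀ x ∈ Ioo a b, W x = Complex.exp ((Φ x : ℂ) * I) := by
    intro x hx
    have h1 : W x = Complex.exp (∑ k, (n k : ℂ) * ((Real.arctan (s k * g k x) : ℂ) * I)) := by
      rw [Complex.exp_sum]
      refine Finset.prod_congr rfl fun k _ => ?_
      rw [hu_exp, ← Complex.exp_nat_mul]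
    have h2 : ∀ k, (n k : ℝ) * Real.arctan (s k * g k x) =
        (F k : ℝ) * Complex.arg (w k x) / 2 ^ (m + 1) := fun k => by
      rw [hsarctan k, hgarg k x hx, ← hsn k]; ring
    have h3 : (∑ k, (n k : ℂ) * ((Real.arctan (s k * g k x) : ℂ) * I)) = ((Φ x : ℝ) : ℂ) * I := by
      have h4 : ∀ k, (n k : ℂ) * ((Real.arctan (s k * g k x) : ℂ) * I) =
          (((n k : ℝ) * Real.arctan (s k * g k x) : ℝ) : ℂ) * I := fun k => by push_cast; ring
      simp_rw [h4, h2, ← Finset.sum_mul, ← Complex.ofReal_sum]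
      congr 2
      rw [hΦ_def]
      simp only [Finset.sum_div]
    rw [h1, h3]
  -- the bound `|Φ| < π/2`
  have hΦ : ∀ x, |Φ x| < π / 2 := by
    intro x
    have hle : |∑ k, (F k : ℝ) * Complex.arg (w k x)| ≤ (∑ k, |(F k : ℝ)|) * π := by
      calc |∑ k, (F k : ℝ) * Complex.arg (w k x)| ≤ ∑ k, |(F k : ℝ) * Complex.arg (w k x)| :=
            Finset.abs_sum_le_sum_abs _ _
        _ ≤ ∑ k, |(F k : ℝ)| * π := Finset.sum_le_sum fun k _ => by
            rw [abs_mul]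
            exact mul_le_mul_of_nonneg_left (Complex.abs_arg_le_pi _) (abs_nonneg _)
        _ = (∑ k, |(F k : ℝ)|) * π := by rw [Finset.sum_mul]
    have hpow : (0:ℝ) < 2 ^ (m + 1) := by positivity
    rw [hΦ_def, abs_div, abs_of_pos hpow, div_lt_iff₀ hpow]
    calc |∑ k, (F k : ℝ) * Complex.arg (w k x)| ≤ (∑ k, |(F k : ℝ)|) * π := hle
      _ < 2 ^ m * π := by gcongr
      _ = π / 2 * 2 ^ (m + 1) := by rw [pow_succ]; ring
  -- `T := im W / re W`
  refine ⟨m, fun x => (W x).im / (W x).re, ?_, ?_, ?_⟩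
  · -- semialgebraic: real and imaginary parts of the `u_k`, then powers and products
    have hc : ∀ k, IsSemialgebraicFunOn ℚ {t : Fin 1 → ℝ | t 0 ∈ Ioo a b}
        (fun t => s k * g k (t 0)) := fun k =>
      (isSemialgebraicFunOn_const_of_isAlgebraic hI (hsalg k)).fun_mul (hgs k)
    have h1 : IsSemialgebraicFunOn ℚ {t : Fin 1 → ℝ | t 0 ∈ Ioo a b} (fun _ => (1:ℝ)) := by
      simpa using isSemialgebraicFunOn_const_natCast hI 1
    have hroot : ∀ k, IsSemialgebraicFunOn ℚ {t : Fin 1 → ℝ | t 0 ∈ Ioo a b}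
        (fun t => (Real.sqrt (1 + (s k * g k (t 0)) ^ 2))⁻¹) := fun k =>
      (IsSemialgebraicFunOn.sqrt_holds ((h1.fun_add ((hc k).fun_mul (hc k))).congr
        fun _ _ => by ring)).fun_inv
    have hur : ∀ k, IsSemialgebraicFunOn ℚ {t : Fin 1 → ℝ | t 0 ∈ Ioo a b}
        (fun t => (u k (t 0)).re) := fun k =>
      (hroot k).congr fun t _ => by simp [hu_def, Complex.mul_re]
    have hui : ∀ k, IsSemialgebraicFunOn ℚ {t : Fin 1 → ℝ | t 0 ∈ Ioo a b}
        (fun t => (u k (t 0)).im) := fun k =>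
      ((hc k).fun_mul (hroot k)).congr fun t _ => by simp [hu_def, Complex.mul_im]
    have hpow : ∀ k, IsSemialgebraicFunOn ℚ {t : Fin 1 → ℝ | t 0 ∈ Ioo a b}
        (fun t => (u k (t 0) ^ n k).re) ∧
        IsSemialgebraicFunOn ℚ {t : Fin 1 → ℝ | t 0 ∈ Ioo a b} (fun t => (u k (t 0) ^ n k).im) :=
      fun k => isSemialgebraicFunOn_re_im_pow hI (hur k) (hui k) (n k)
    have hprod := isSemialgebraicFunOn_re_im_prod (u := fun k x => u k x ^ n k) hI
      (fun k => (hpow k).1) (fun k => (hpow k).2) Finset.univ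
    exact (hprod.2.fun_mul hprod.1.fun_inv).congr fun t _ => by simp only [hW_def, div_eq_mul_inv]
  · -- analytic
    intro x hx
    have hofReal : ∀ {f : ℝ → ℝ}, AnalyticAt ℝ f x → AnalyticAt ℝ (fun y => ((f y : ℝ) : ℂ)) x :=
      fun hf => (Complex.ofRealCLM.analyticAt _).comp hf
    have hua : ∀ k, AnalyticAt ℝ (u k) x := by
      intro k
      have hsg : AnalyticAt ℝ (fun y => s k * g k y) x := analyticAt_const.mul (hga k x hx)
      have hpos : 0 < 1 + (s k * g k x) ^ 2 := by positivity
      have hsq : AnalyticAt ℝ (fun y => (Real.sqrt (1 + (s k * g k y) ^ 2))⁻¹) x := by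
        have h := analyticAt_rpow_const_comp (analyticAt_const.add (hsg.pow 2)) hpos (1 / 2 : ℝ)
        refine (h.congr ?_).inv (Real.sqrt_pos.mpr hpos).ne'
        filter_upwards with y
        rw [Real.sqrt_eq_rpow]
        rfl
      exact (analyticAt_const.add ((hofReal hsg).mul analyticAt_const)).mul (hofReal hsq)
    have hWa : AnalyticAt ℝ W x := by
      simp only [hW_def]
      exact Finset.analyticAt_fun_prod _ fun k _ => (hua k).pow (n k)
    have hWre : AnalyticAt ℝ (fun y => (W y).re) x := (Complex.reCLM.analyticAt _).comp hWa
    have hWim : AnalyticAt ℝ (fun y => (W y).im) x := (Complex.imCLM.analyticAt _).comp hWa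
    refine hWim.div hWre ?_
    rw [hW x hx, Complex.exp_ofReal_mul_I_re]
    exact (Real.cos_pos_of_mem_Ioo ⟨by linarith [abs_lt.mp (hΦ x)], by linarith [abs_lt.mp (hΦ x)]⟩).ne'
  · -- the identity
    intro x hx
    simp only
    rw [hW x hx, arctan_im_div_re_exp (hΦ x)]

end KZ.DilationArctanSector

end Literature.NumberTheory.Transcendental
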